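import Literature.Probability.Percolation.GrimmettMarstrand
import HarnessLib

/-!
# Stub `stub_planar` of crux `ModelFacts` (stmt-CriticalPhenomena-16064), line `pushforward`

Crux: `Summit.CriticalPhenomena.PercolationContinuityZ3.Theses.PercExchangeRateTransport.ModelFacts`
(bookkeeping for the label-coupled anisotropic bond-percolation family on `ℤ²×ℤ`), registered
skeleton `Cruxes/ModelFacts/Lines/pushforward.lean` (sha b7532b73). This file proves the hardest
registered stub VERBATIM:

`stub_planar : ∀ p : unitInterval, (labelMeasure (Site 3)).real {U | {e | e ∈ E(ℤ³) ∧ ¬ vert e ∧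
  U e ≤ p} ∈ percolatesAt 0} = theta (zdGraph 2) 0 p`

— percolation of the origin through the HORIZONTAL bonds of `ℤ³` (label `≤ p`) has probability
`θ_{ℤ²}(p)` (clause (10) of the crux, the planar end `t = 0`, after the null set `{U_e ≤ 0}` is
removed in the skeleton's glue). Below, `Vert = {e | ∃ x, e = s(x, x + e₂)}` denotes the set of
vertical bonds (written out in full in the statements; no definition is introduced).

Argument (idea card `ambient-comap-planar-end`, crux-ideate r1 k1; Grimmett 1999 §1.4/§1.6):
* `comap_padSite_three`: the layer embedding `padSite 3 : Site 2 → Site 3`, `u ↦ (u₀, u₁, 0)`,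
  pulls `ℤ³` back to `ℤ²`;
* layer confinement (`lift_walk`, `horiz_percolatesAt_iff`): for `ω ⊆ E(ℤ³)`, an open path of
  non-vertical bonds from the origin stays on the layer `{x₂ = 0}` and is the image of an open
  path of `restrictConfig (padSite 3) ω`; conversely the image of the planar cluster lies in the
  horizontal cluster (`finite_openCluster_restrictConfig`); so
  `ω ∖ Vert ∈ percolatesAt 0 ↔ restrictConfig (padSite 3) ω ∈ percolatesAt 0`;
* `planar_end_ambient`: under `P_p^{ℤ³}` the horizontal event has probability `θ_{ℤ²}(p)`
  (`theta_comap_eq`, configurations are a.s. carried by `E(ℤ³)`);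
* `stub_planar`: the horizontal label configuration IS `configOfLabels p U (zdGraph 3) ∖ Vert`
  (surely), so the one-level coupling `map_configOfLabels_holds` moves the statement to
  `P_p^{ℤ³}`.

Tree lemmas used: `theta_comap_eq`, `finite_openCluster_restrictConfig`, `restrictConfig`,
`padSite`, `padSite_injective`, `zdGraph_adj_padSite`, `map_configOfLabels_holds`,
`measurable_configOfLabels`, `measurableSet_percolatesAt_holds`, `setBernoulli_ae_subset`.
-/

noncomputable section

open MeasureTheory
open Literature.Probability.Percolation Literature.Probability.LatticeModels

namespace Summit.CriticalPhenomena.PercolationContinuityZ3.Theorems.ModelFacts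

namespace Planar

/-! ## Card `ambient-comap-planar-end` -/

/-- First lemma (a): the layer embedding pulls `ℤ³` back to `ℤ²` —
`(zdGraph 3).comap padSite = zdGraph 2`. [folklore] -/
theorem comap_padSite_three : (zdGraph 3).comap (padSite 3) = zdGraph 2 := by
  ext u v
  simp only [SimpleGraph.comap_adj]
  constructor
  · intro h
    rw [zdGraph_adj_iff] at h ⊢
    obtain ⟨i, h⟩ := h
    -- the unit vector must be horizontal: compare third coordinates
    have hi : (i : ℕ) < 2 := by
      rcases h with h | h
      · have := congrFun h i
        by_contra hi
        simp [padSite, hi] at this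
      · have := congrFun h i
        by_contra hi
        simp [padSite, hi] at this
    refine ⟨⟨i, hi⟩, ?_⟩
    have hcast : Fin.castLE (show 2 ≤ 3 by norm_num) ⟨i, hi⟩ = i := Fin.ext rfl
    rcases h with h | h
    · left
      apply padSite_injective (d := 3) (by norm_num)
      rw [padSite_add, padSite_single (by norm_num), hcast]
      exact h
    · right
      apply padSite_injective (d := 3) (by norm_num)
      rw [padSite_add, padSite_single (by norm_num), hcast]
      exact h
  · exact zdGraph_adj_padSite (by norm_num)

/-- First lemma (b): a lattice step along a NON-vertical bond from a point of the layer is the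
`padSite`-image of a planar lattice step. [folklore] -/
theorem horiz_step {u x : Site 3} (hE : (zdGraph 3).Adj u x)
    (hnv : s(u, x) ∉ {e : Sym2 (Site 3) | ∃ x : Site 3, e = s(x, x + Pi.single (2 : Fin 3) 1)})
    (a : Site 2) (ha : padSite 3 a = u) :
    ∃ a' : Site 2, padSite 3 a' = x ∧ (zdGraph 2).Adj a a' := by
  rw [zdGraph_adj_iff] at hE
  obtain ⟨i, hi⟩ := hE
  have two_le : (2 : ℕ) ≤ 3 := by norm_num
  -- the step is horizontal: a vertical unit vector would make `s(u, x)` a vertical bond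
  have hi2 : (i : ℕ) < 2 := by
    by_contra hlt
    apply hnv
    simp only [Set.mem_setOf_eq]
    fin_cases i
    · simp at hlt
    · simp at hlt
    · rcases hi with h | h
      · exact ⟨u, by rw [h]; rfl⟩
      · exact ⟨x, by rw [h, Sym2.eq_swap]; rfl⟩
  set j : Fin 2 := ⟨i, hi2⟩ with hj
  have hcast : Fin.castLE two_le j = i := Fin.ext rfl
  rcases hi with h | h
  · refine ⟨a + Pi.single j 1, ?_, ?_⟩
    · rw [padSite_add, padSite_single two_le, hcast, ha, h]
    · rw [zdGraph_adj_iff]; exact ⟨j, Or.inl rfl⟩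
  · refine ⟨a - Pi.single j 1, ?_, ?_⟩
    · have hpad : padSite 3 (a - Pi.single j 1) + padSite 3 (Pi.single j 1) = padSite 3 a := by
        rw [← padSite_add, sub_add_cancel]
      rw [padSite_single two_le, hcast, ha, h] at hpad
      exact add_right_cancel hpad
    · rw [zdGraph_adj_iff]; exact ⟨j, Or.inr (sub_add_cancel a _).symm⟩

/-- Layer confinement: an open path of horizontal lattice bonds starting on the layer `x₂ = 0`
stays on it and is the `padSite`-image of an open path of the restricted planar configuration.
[folklore] -/
theorem lift_walk {ω : BondConfig (Site 3)} (hω : ω ⊆ (zdGraph 3).edgeSet) {u v : Site 3}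
    (w : (openGraph
      (ω \ {e : Sym2 (Site 3) | ∃ x : Site 3, e = s(x, x + Pi.single (2 : Fin 3) 1)})).Walk u v) :
    ∀ a : Site 2, padSite 3 a = u →
      ∃ b : Site 2, padSite 3 b = v ∧ (openGraph (restrictConfig (padSite 3)
        (ω \ {e : Sym2 (Site 3) | ∃ x : Site 3, e = s(x, x + Pi.single (2 : Fin 3) 1)}))).Reachable
          a b := by
  induction w with
  | nil => intro a ha; exact ⟨a, ha, SimpleGraph.Reachable.refl _⟩
  | @cons u x v hadj w' ih =>
    intro a ha
    rw [openGraph_adj] at hadj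
    obtain ⟨hmem, hne⟩ := hadj
    have hE : (zdGraph 3).Adj u x := hω hmem.1
    obtain ⟨a', ha', hadj2⟩ := horiz_step hE hmem.2 a ha
    obtain ⟨b, hb, hreach⟩ := ih a' ha'
    refine ⟨b, hb, ?_⟩
    have h1 : (openGraph (restrictConfig (padSite 3)
        (ω \ {e : Sym2 (Site 3) | ∃ x : Site 3, e = s(x, x + Pi.single (2 : Fin 3) 1)}))).Adj
          a a' := by
      rw [openGraph_adj]
      refine ⟨?_, hadj2.ne⟩
      rw [mem_restrictConfig, Sym2.map_mk, ha, ha']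
      exact hmem
    exact h1.reachable.trans hreach

/-- No vertical bond is the `padSite`-image of a planar pair. [folklore] -/
theorem map_padSite_notMem_vert (e : Sym2 (Site 2)) :
    e.map (padSite 3) ∉ {e : Sym2 (Site 3) | ∃ x : Site 3, e = s(x, x + Pi.single (2 : Fin 3) 1)} := by
  induction e using Sym2.ind with
  | h a b =>
    rintro ⟨x, hx⟩
    rw [Sym2.map_mk, Sym2.eq_iff] at hx
    have h2a : padSite 3 a 2 = 0 := by simp [padSite]
    have h2b : padSite 3 b 2 = 0 := by simp [padSite]
    rcases hx with ⟨h1, h2⟩ | ⟨h1, h2⟩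
    · have := congrFun h2 2
      rw [h2b, Pi.add_apply, ← h1, h2a] at this
      simp at this
    · have := congrFun h1 2
      rw [h2a, Pi.add_apply, ← h2, h2b] at this
      simp at this

/-- **Layer confinement, event form.** For a configuration `ω ⊆ E(ℤ³)`, the origin percolates
through the non-vertical bonds of `ω` iff it percolates in the planar configuration
`restrictConfig (padSite 3) ω` pulled back along the layer embedding (`lift_walk` one way,
`finite_openCluster_restrictConfig` the other). [folklore] -/
theorem horiz_percolatesAt_iff {ω : BondConfig (Site 3)} (hω : ω ⊆ (zdGraph 3).edgeSet) :
    ω \ {e : Sym2 (Site 3) | ∃ x : Site 3, e = s(x, x + Pi.single (2 : Fin 3) 1)} ∈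
        percolatesAt (0 : Site 3) ↔
      restrictConfig (padSite 3) ω ∈ percolatesAt (0 : Site 2) := by
  set V : Set (Sym2 (Site 3)) := {e | ∃ x : Site 3, e = s(x, x + Pi.single (2 : Fin 3) 1)} with hV
  have hres : restrictConfig (padSite 3) ω = restrictConfig (padSite 3) (ω \ V) := by
    ext e
    simp only [mem_restrictConfig, Set.mem_sdiff]
    exact ⟨fun h => ⟨h, map_padSite_notMem_vert e⟩, fun h => h.1⟩
  simp only [percolatesAt, Set.mem_setOf_eq]
  rw [hres]
  constructor
  · intro h3
    have hsub : openCluster (ω \ V) (0 : Site 3) ⊆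
        padSite 3 '' openCluster (restrictConfig (padSite 3) (ω \ V)) 0 := by
      intro y hy
      have hy' : (openGraph (ω \ V)).Reachable 0 y := hy
      obtain ⟨w⟩ := hy'
      obtain ⟨b, hb, hreach⟩ := lift_walk hω w 0 padSite_zero
      exact ⟨b, hreach, hb⟩
    exact Set.Infinite.of_image _ (h3.mono hsub)
  · intro h2
    by_contra h3
    have h3' : (openCluster (ω \ V) (padSite 3 (0 : Site 2))).Finite := by
      rw [padSite_zero]; exact Set.not_infinite.1 h3
    exact h2 (finite_openCluster_restrictConfig (padSite_injective (d := 3) (by norm_num))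
      (ω \ V) 0 h3')

/-- Target reformulation of `stub_planar` in ambient form: under `P_p^{ℤ³}` the horizontal
percolation event has probability `θ_{ℤ²}(p)` (`theta_comap_eq` + `comap_padSite_three` +
`horiz_percolatesAt_iff` a.s., `setBernoulli_ae_subset`). [folklore] -/
theorem planar_end_ambient (p : unitInterval) :
    (bondPercolation (zdGraph 3) p).real {ω |
      ω \ {e : Sym2 (Site 3) | ∃ x : Site 3, e = s(x, x + Pi.single (2 : Fin 3) 1)} ∈
        percolatesAt (0 : Site 3)} = theta (zdGraph 2) 0 p := by
  have h := theta_comap_eq (zdGraph 3) (padSite_injective (d := 3) (by norm_num)) (0 : Site 2) p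
  rw [comap_padSite_three] at h
  rw [h]
  apply measureReal_congr
  have hsub : ∀ᵐ ω ∂(bondPercolation (zdGraph 3) p), ω ⊆ (zdGraph 3).edgeSet :=
    ProbabilityTheory.setBernoulli_ae_subset
  filter_upwards [hsub] with ω hω
  exact propext (horiz_percolatesAt_iff hω)

/-- `ω ↦ ω ∖ Vert` is measurable (coordinatewise). [folklore] -/
theorem measurable_sdiff_vert : Measurable (fun ω : BondConfig (Site 3) =>
    ω \ {e : Sym2 (Site 3) | ∃ x : Site 3, e = s(x, x + Pi.single (2 : Fin 3) 1)}) :=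
  measurable_set_iff.2 fun e => (measurable_set_mem e).and measurable_const

end Planar

open Planar in
/-- **Registered stub `stub_planar` of line `pushforward` (crux `ModelFacts`,
stmt-CriticalPhenomena-16064), verbatim.** Percolation of the origin through the horizontal bonds
`{e ∈ E(ℤ³) | e not vertical, U e ≤ p}` of i.i.d. uniform labels has probability `θ_{ℤ²}(p)`.
Proof: the horizontal label configuration is `configOfLabels p U (zdGraph 3) ∖ Vert` surely, so
`map_configOfLabels_holds` moves the statement to `P_p^{ℤ³}`, where `planar_end_ambient` applies.
[folklore] -/
theorem stub_planar :
    ∀ p : unitInterval,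
    (labelMeasure (Site 3)).real {U |
      {e | e ∈ (zdGraph 3).edgeSet ∧ ¬ (∃ x : Site 3, e = s(x, x + Pi.single (2 : Fin 3) 1)) ∧
        U e ≤ (p : ℝ)} ∈ percolatesAt (0 : Site 3)} = theta (zdGraph 2) 0 p := by
  intro p
  set V : Set (Sym2 (Site 3)) := {e | ∃ x : Site 3, e = s(x, x + Pi.single (2 : Fin 3) 1)} with hV
  have hmeas : MeasurableSet {ω : BondConfig (Site 3) | ω \ V ∈ percolatesAt (0 : Site 3)} :=
    measurable_sdiff_vert (measurableSet_percolatesAt_holds 0)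
  have hset : {U : Sym2 (Site 3) → ℝ |
      {e | e ∈ (zdGraph 3).edgeSet ∧ ¬ (∃ x : Site 3, e = s(x, x + Pi.single (2 : Fin 3) 1)) ∧
        U e ≤ (p : ℝ)} ∈ percolatesAt (0 : Site 3)} =
      (fun U : Sym2 (Site 3) → ℝ => configOfLabels (p : ℝ) U (zdGraph 3)) ⁻¹'
        {ω | ω \ V ∈ percolatesAt (0 : Site 3)} := by
    ext U
    simp only [Set.mem_setOf_eq, Set.mem_preimage]
    have : {e | e ∈ (zdGraph 3).edgeSet ∧ ¬ (∃ x : Site 3, e = s(x, x + Pi.single (2 : Fin 3) 1)) ∧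
        U e ≤ (p : ℝ)} = configOfLabels (p : ℝ) U (zdGraph 3) \ V := by
      ext e
      simp only [hV, configOfLabels, Set.mem_sdiff, Set.mem_setOf_eq]
      tauto
    rw [this]
  rw [hset, ← map_measureReal_apply (measurable_configOfLabels _ _) hmeas,
    map_configOfLabels_holds (zdGraph 3) p]
  exact planar_end_ambient p

end Summit.CriticalPhenomena.PercolationContinuityZ3.Theorems.ModelFacts

end
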